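import Mathlib
import Summits.MatrixMultiplication.MatrixMultiplication.Theorems.SubgroupIdentityDesigns.Negative.NormaliserImages
import Summits.MatrixMultiplication.MatrixMultiplication.Theorems.SubgroupIdentityDesigns.Negative.FullImageSplit
import Summits.MatrixMultiplication.MatrixMultiplication.Theorems.SubgroupIdentityDesigns.Negative.LineCertificate

/-!
# Singer-normaliser members of full projective size are line-transitive (`p` odd)

Route `LevelGradedCohnUmans`, crux `SubgroupIdentityDesigns` (stmt-MatrixMultiplication-14079), the
`(m,k) = (2,1)` cell.  VALUE = THEOREM, NOT summit progress; the crux item is untouched and remains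
open.

Let `E ≤ GL₂(𝔽_p)` (`p` odd) be conjugate into the normaliser `N(C_n)` of a non-split torus
(`IsSingerNormal n`, `n` a non-square), with a free vector, with `|E| = |E ∩ Z| · (p + 1)` and with a
NON-SQUARE central element.  Then `E` acts transitively on the `p + 1` lines of `𝔽_p²`
(`lineTransitive_of_conj_singerNormal`).  These are exactly the hypotheses met by every member of a
family-I witness triple of the Dickson sieve (`DicksonFamilyI.lean`, `FamilyIArithmetic.lean`), so
together with `LineTransitiveMember.lean` this empties family I for all `p` (`CellTwoOneClosed.lean`).

Proof.  (A) `eq_scalarHom_of_eigen`: an element `e ∈ E` with an eigenvector at the free vector,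
`e a₀ = μ a₀`, is the scalar `μ`: its conjugate `x ∈ N(C_n)` has an eigenvector, so either `x` has
shape⁺ and is scalar (`n` is a non-square), or `x` has shape⁻ and `x² = μ²·1`; in the second case
`μ² ∈ E ∩ Z`, hence `μ ∈ E ∩ Z` (`units_mem_of_sq_mem`, the non-square central element), and
`μ⁻¹ e` fixes `a₀`, so `e = μ`.  (B) counting: by (A) the map `e ↦ [e a₀] ∈ ℙ¹` has fibres of size
`≤ |E ∩ Z|`; if a line were missed, `|E| ≤ |E ∩ Z| · p < |E|`.
-/

set_option linter.dupNamespace false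

noncomputable section

open scoped BigOperators Classical

open Summit.MatrixMultiplication.MatrixMultiplication.Theorems.LieRankDesigns.Negative (GLm Mat)

namespace Summit.MatrixMultiplication.MatrixMultiplication.Theorems.SubgroupIdentityDesigns.Negative

section SingerLineTransitive

variable {p : ℕ} [hp : Fact p.Prime]

/-- `e⁻¹ (e x) = x`. -/
theorem inv_mulVec_mulVec (e : GLm p 2) (x : Fin 2 → ZMod p) :
    ((e⁻¹ : GLm p 2) : Mat p 2).mulVec ((e : Mat p 2).mulVec x) = x := by
  rw [Matrix.mulVec_mulVec, ← Units.val_mul, inv_mul_cancel, Units.val_one, Matrix.one_mulVec]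

/-- **Shape analysis.**  A Singer-normal element (`n` a non-square) with an eigenvector `v ≠ 0`,
`x v = μ v`: shape⁺ forces `x = μ·1`, shape⁻ forces `x² = μ²·1`. -/
theorem isSingerNormal_eigen_dichotomy {n : ZMod p} (hn : ∀ y : ZMod p, y * y ≠ n) {x : GLm p 2}
    (hx : IsSingerNormal n x) {v : Fin 2 → ZMod p} (hv : v ≠ 0) {μ : ZMod p}
    (hμ : (x : Mat p 2).mulVec v = μ • v) :
    (x : Mat p 2) = μ • (1 : Mat p 2) ∨
      ((x * x : GLm p 2) : Mat p 2) = (μ * μ) • (1 : Mat p 2) := by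
  have E1 : (x : Mat p 2) 0 0 * v 0 + (x : Mat p 2) 0 1 * v 1 = μ * v 0 := by
    have := congrFun hμ 0
    simpa [Matrix.mulVec, dotProduct, Fin.sum_univ_two] using this
  have E2 : (x : Mat p 2) 1 0 * v 0 + (x : Mat p 2) 1 1 * v 1 = μ * v 1 := by
    have := congrFun hμ 1
    simpa [Matrix.mulVec, dotProduct, Fin.sum_univ_two] using this
  have hK : ∀ K : ZMod p, K * v 0 = 0 → K * v 1 = 0 → K = 0 := by
    intro K h0 h1
    by_contra hK
    apply hv
    funext i
    fin_cases i
    · exact (mul_eq_zero.mp h0).resolve_left hK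
    · exact (mul_eq_zero.mp h1).resolve_left hK
  rcases hx with ⟨h01, h11⟩ | ⟨h01, h11⟩
  · left
    rw [h01] at E1
    rw [h11] at E2
    -- `(x₀₀ - μ)² = n x₁₀²`
    have hsq : ((x : Mat p 2) 0 0 - μ) * ((x : Mat p 2) 0 0 - μ) -
        n * ((x : Mat p 2) 1 0 * (x : Mat p 2) 1 0) = 0 := by
      refine hK _ ?_ ?_
      · linear_combination ((x : Mat p 2) 0 0 - μ) * E1 - n * (x : Mat p 2) 1 0 * E2
      · linear_combination ((x : Mat p 2) 0 0 - μ) * E2 - (x : Mat p 2) 1 0 * E1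
    have hb : (x : Mat p 2) 1 0 = 0 := by
      by_contra hb
      refine hn (((x : Mat p 2) 0 0 - μ) * ((x : Mat p 2) 1 0)⁻¹) ?_
      field_simp
      linear_combination hsq
    have ha : (x : Mat p 2) 0 0 = μ := by
      rw [hb, mul_zero, mul_zero, sub_zero, mul_self_eq_zero, sub_eq_zero] at hsq
      exact hsq
    ext i j
    fin_cases i <;> fin_cases j
    · simpa using ha
    · simp [h01, hb]
    · simpa using hb
    · simp [h11, ha]
  · right
    rw [h01] at E1
    rw [h11] at E2
    -- `x₀₀² - n x₁₀² = μ²`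
    have hσ : (x : Mat p 2) 0 0 * (x : Mat p 2) 0 0 - n * ((x : Mat p 2) 1 0 * (x : Mat p 2) 1 0) -
        μ * μ = 0 := by
      refine hK _ ?_ ?_
      · linear_combination ((x : Mat p 2) 0 0 + μ) * E1 - n * (x : Mat p 2) 1 0 * E2
      · linear_combination (x : Mat p 2) 1 0 * E1 - ((x : Mat p 2) 0 0 - μ) * E2
    ext i j
    fin_cases i <;> fin_cases j
    · simp only [Fin.zero_eta, Fin.isValue, gl2_mul_apply, Matrix.smul_apply, Matrix.one_apply_eq,
        smul_eq_mul, mul_one, h01]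
      linear_combination hσ
    · simp only [Fin.zero_eta, Fin.isValue, Fin.mk_one, gl2_mul_apply, h01, h11, Matrix.smul_apply,
        ne_eq, zero_ne_one, not_false_eq_true, Matrix.one_apply_ne, smul_eq_mul, mul_zero]
      ring
    · simp only [Fin.mk_one, Fin.isValue, Fin.zero_eta, gl2_mul_apply, h11, Matrix.smul_apply,
        ne_eq, one_ne_zero, not_false_eq_true, Matrix.one_apply_ne, smul_eq_mul, mul_zero]
      ring
    · simp only [Fin.mk_one, Fin.isValue, gl2_mul_apply, h01, h11, Matrix.smul_apply,
        Matrix.one_apply_eq, smul_eq_mul, mul_one]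
      linear_combination hσ

/-- **(A) An eigenvector at the free vector forces a scalar.**  `E` conjugate into `N(C_n)` (`n` a
non-square, `p` odd), `a₀` a free vector of `E`, `E ∩ Z` containing a non-square; if `e ∈ E` has
`e a₀ = μ a₀` then `e = μ·1`. -/
theorem eq_scalarHom_of_eigen (hp2 : p ≠ 2) {n : ZMod p} (hn : ∀ y : ZMod p, y * y ≠ n)
    {E : Subgroup (GLm p 2)} {g : GLm p 2} (hg : ∀ x ∈ E, IsSingerNormal n (g * x * g⁻¹))
    {a₀ : Fin 2 → ZMod p} (ha₀ : a₀ ≠ 0)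
    (hfree : ∀ h ∈ E, ((h : GLm p 2) : Mat p 2).mulVec a₀ = a₀ → h = 1)
    (hns : ∃ s₀ ∈ E.comap (scalarHom p 2), ¬ IsSquare s₀)
    {e : GLm p 2} (he : e ∈ E) {μ : (ZMod p)ˣ}
    (hμ : (e : Mat p 2).mulVec a₀ = (μ : ZMod p) • a₀) : e = scalarHom p 2 μ := by
  obtain ⟨s₀, hs₀, hns₀⟩ := hns
  -- the conjugate `x = g e g⁻¹` has the eigenvector `g a₀`
  have hxv : ((g * e * g⁻¹ : GLm p 2) : Mat p 2).mulVec ((g : Mat p 2).mulVec a₀) =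
      (μ : ZMod p) • (g : Mat p 2).mulVec a₀ := by
    rw [Matrix.mulVec_mulVec, ← Units.val_mul, inv_mul_cancel_right, Units.val_mul,
      ← Matrix.mulVec_mulVec, hμ, Matrix.mulVec_smul]
  -- key: the scalar `μ` lies in `E`
  have hμE : scalarHom p 2 μ ∈ E := by
    rcases isSingerNormal_eigen_dichotomy hn (hg e he) (gl2_mulVec_ne_zero g ha₀) hxv with
      hplus | hminus
    · -- shape⁺: `g e g⁻¹ = μ`, so `e = μ`
      have hx : g * e * g⁻¹ = scalarHom p 2 μ := by
        apply Units.ext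
        rw [hplus, coe_scalarHom, Matrix.scalar_apply, Matrix.smul_one_eq_diagonal]
      have hex : e = scalarHom p 2 μ := by
        calc e = g⁻¹ * (g * e * g⁻¹) * g := by group
          _ = scalarHom p 2 μ := by
            rw [hx, mul_assoc, scalarHom_comm, ← mul_assoc, inv_mul_cancel, one_mul]
      rw [← hex]
      exact he
    · -- shape⁻: `e² = μ²`, so `μ² ∈ E ∩ Z`, so `μ ∈ E ∩ Z`
      have hxx : g * (e * e) * g⁻¹ = scalarHom p 2 (μ * μ) := by
        apply Units.ext
        have e1 : g * (e * e) * g⁻¹ = (g * e * g⁻¹) * (g * e * g⁻¹) := by group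
        rw [e1, hminus, coe_scalarHom, Matrix.scalar_apply, Matrix.smul_one_eq_diagonal,
          Units.val_mul]
      have hee : e * e = scalarHom p 2 (μ * μ) := by
        calc e * e = g⁻¹ * (g * (e * e) * g⁻¹) * g := by group
          _ = scalarHom p 2 (μ * μ) := by
            rw [hxx, mul_assoc, scalarHom_comm, ← mul_assoc, inv_mul_cancel, one_mul]
      have hsq : μ ^ 2 ∈ E.comap (scalarHom p 2) := by
        rw [Subgroup.mem_comap, pow_two, ← hee]
        exact E.mul_mem he he
      exact Subgroup.mem_comap.mp (units_mem_of_sq_mem hp2 (E.comap (scalarHom p 2)) hs₀ hns₀ hsq)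
  -- `μ⁻¹ e` fixes `a₀`
  have hfix : (((scalarHom p 2 μ)⁻¹ * e : GLm p 2) : Mat p 2).mulVec a₀ = a₀ := by
    rw [← map_inv, coe_scalarHom_mul, Matrix.smul_mulVec, hμ, smul_smul, Units.inv_mul,
      one_smul]
  have h1 := hfree _ (E.mul_mem (E.inv_mem hμE) he) hfix
  rw [inv_mul_eq_one] at h1
  exact h1.symm

/-- **SINGER-NORMALISER MEMBERS OF FULL PROJECTIVE SIZE ARE LINE-TRANSITIVE.**  `p` odd, `n` a
non-square; `E` conjugate into `N(C_n)`, with a free vector, `|E| = |E ∩ Z|·(p+1)`, and a non-square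
in `E ∩ Z`.  Then for all `v, w ≠ 0` some `e ∈ E` maps `v` into the line `𝔽_p w`. -/
theorem lineTransitive_of_conj_singerNormal (hp2 : p ≠ 2) {n : ZMod p}
    (hn : ∀ y : ZMod p, y * y ≠ n) {E : Subgroup (GLm p 2)} {g : GLm p 2}
    (hg : ∀ x ∈ E, IsSingerNormal n (g * x * g⁻¹))
    (hcard : Nat.card E = Nat.card (E.comap (scalarHom p 2)) * (p + 1))
    (hfree : ∃ a, a ≠ 0 ∧ ∀ h ∈ E, ((h : GLm p 2) : Mat p 2).mulVec a = a → h = 1)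
    (hns : ∃ s₀ ∈ E.comap (scalarHom p 2), ¬ IsSquare s₀) :
    ∀ v w : Fin 2 → ZMod p, v ≠ 0 → w ≠ 0 →
      ∃ e ∈ E, ∃ ν : ZMod p, ((e : GLm p 2) : Mat p 2).mulVec v = ν • w := by
  obtain ⟨a₀, ha₀, hfreeE⟩ := hfree
  -- (B) every line is hit by the orbit of `a₀`
  have hline : ∀ (u : Fin 2 → ZMod p) (hu : u ≠ 0), ∃ e ∈ E,
      Projectivization.mk (ZMod p) (((e : GLm p 2) : Mat p 2).mulVec a₀) (gl2_mulVec_ne_zero e ha₀) =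
        Projectivization.mk (ZMod p) u hu := by
    intro u hu
    by_contra hmiss
    push Not at hmiss
    haveI : Fintype (Projectivization (ZMod p) (Fin 2 → ZMod p)) := Fintype.ofFinite _
    have hcardP : Fintype.card (Projectivization (ZMod p) (Fin 2 → ZMod p)) = p + 1 := by
      rw [← Nat.card_eq_fintype_card, Projectivization.card_of_finrank_two (ZMod p) (Fin 2 → ZMod p)
        (Module.finrank_fin_fun (ZMod p)), Nat.card_zmod]
    set sE : Finset (GLm p 2) := Finset.univ.filter (· ∈ E) with hsE_def
    set SE : Finset (ZMod p)ˣ := Finset.univ.filter (fun t => t ∈ E.comap (scalarHom p 2))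
      with hSE_def
    set T : Finset (Projectivization (ZMod p) (Fin 2 → ZMod p)) :=
      Finset.univ.erase (Projectivization.mk (ZMod p) u hu) with hT_def
    set f : GLm p 2 → Projectivization (ZMod p) (Fin 2 → ZMod p) := fun e =>
      Projectivization.mk (ZMod p) ((e : Mat p 2).mulVec a₀) (gl2_mulVec_ne_zero e ha₀) with hf_def
    have hsE : sE.card = Nat.card E :=
      (Nat.subtype_card sE (fun x => by simp [hsE_def])).symm
    have hSE : SE.card = Nat.card (E.comap (scalarHom p 2)) :=
      (Nat.subtype_card SE (fun x => by simp [hSE_def])).symm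
    have hT : T.card = p := by
      rw [hT_def, Finset.card_erase_of_mem (Finset.mem_univ _), Finset.card_univ, hcardP,
        Nat.add_sub_cancel]
    have hmaps : ∀ e ∈ sE, f e ∈ T := by
      intro e he
      have heE : e ∈ E := by simpa [hsE_def] using he
      exact Finset.mem_erase.mpr ⟨hmiss e heE, Finset.mem_univ _⟩
    have hfib : ∀ ℓ ∈ T, (sE.filter (fun e => f e = ℓ)).card ≤ SE.card := by
      intro ℓ _
      rcases (sE.filter (fun e => f e = ℓ)).eq_empty_or_nonempty with h0 | ⟨e₀, he₀⟩
      · rw [h0, Finset.card_empty]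
        exact Nat.zero_le _
      obtain ⟨he₀s, he₀ℓ⟩ := Finset.mem_filter.mp he₀
      have he₀E : e₀ ∈ E := by simpa [hsE_def] using he₀s
      calc (sE.filter (fun e => f e = ℓ)).card
          ≤ (SE.image (fun t => e₀ * scalarHom p 2 t)).card := Finset.card_le_card ?_
        _ ≤ SE.card := Finset.card_image_le
      intro e he
      obtain ⟨hes, heℓ⟩ := Finset.mem_filter.mp he
      have heE : e ∈ E := by simpa [hsE_def] using hes
      have hff : f e = f e₀ := heℓ.trans he₀ℓ.symm
      obtain ⟨μ, hμ⟩ := (Projectivization.mk_eq_mk_iff (ZMod p) _ _ _ _).mp hff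
      have heig : ((e₀⁻¹ * e : GLm p 2) : Mat p 2).mulVec a₀ = (μ : ZMod p) • a₀ := by
        rw [Units.val_mul, ← Matrix.mulVec_mulVec, ← hμ, Units.smul_def, Matrix.mulVec_smul,
          inv_mulVec_mulVec]
      have hA := eq_scalarHom_of_eigen hp2 hn hg ha₀ hfreeE hns
        (E.mul_mem (E.inv_mem he₀E) heE) heig
      refine Finset.mem_image.mpr ⟨μ, ?_, ?_⟩
      · simp only [hSE_def, Finset.mem_filter, Finset.mem_univ, true_and, Subgroup.mem_comap]
        rw [← hA]
        exact E.mul_mem (E.inv_mem he₀E) heE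
      · rw [← hA, mul_inv_cancel_left]
    have hle := Finset.card_le_mul_card_image_of_maps_to hmaps SE.card hfib
    rw [hsE, hSE, hT, hcard] at hle
    have hS : 0 < Nat.card (E.comap (scalarHom p 2)) := Nat.card_pos
    nlinarith
  -- transitivity from the orbit of `a₀`
  intro v w hv hw
  obtain ⟨e₁, he₁, h₁⟩ := hline v hv
  obtain ⟨e₂, he₂, h₂⟩ := hline w hw
  rw [Projectivization.mk_eq_mk_iff] at h₁ h₂
  obtain ⟨a, ha⟩ := h₁
  obtain ⟨b, hb⟩ := h₂
  refine ⟨e₂ * e₁⁻¹, E.mul_mem he₂ (E.inv_mem he₁),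
    ((a⁻¹ : (ZMod p)ˣ) : ZMod p) * (b : ZMod p), ?_⟩
  have hv' : v = ((a⁻¹ : (ZMod p)ˣ) : ZMod p) • ((e₁ : Mat p 2).mulVec a₀) := by
    rw [← ha, Units.smul_def, smul_smul, Units.inv_mul, one_smul]
  rw [hv', Matrix.mulVec_smul, Units.val_mul, ← Matrix.mulVec_mulVec, inv_mulVec_mulVec, ← hb,
    Units.smul_def, smul_smul]

end SingerLineTransitive

end Summit.MatrixMultiplication.MatrixMultiplication.Theorems.SubgroupIdentityDesigns.Negative

end
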